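import Literature.MathematicalPhysics.StatisticalMechanics.HcpFccLatticeSums

/-!
# Certified hcp/fcc lattice sums: kernel-evaluated box floor sums (KernelA2)

Each theorem records the exact value of an integer box floor sum
`boxFloorSum 2 3 δ k R n 10^e = ∑_{|i|,|j| ≤ R} ⌊10^e / latticeNum 2 3 δ k i jⁿ⌋` (`c² = 2/3`; pattern
`δ`, layer `k`; `R = 40`, `n = 3`, `e = 18` resp. `R = 20`, `n = 6`, `e = 30`), evaluated by the
kernel (`decide +kernel`: structural recursion over the `(2R+1)²` shifted indices, GMP integer
arithmetic; no `native_decide`, standard axioms only).  The values were generated by `py/gen.py`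
from `py/boxsums_final.json` (item evidence) and are re-verified here by the kernel.  [folklore]
-/

namespace Literature.MathematicalPhysics.StatisticalMechanics.StackingSums

open Finset

/-- `boxFloorSum 2 3 0 14 40 3 10^18` (pattern `0`, layer `14`, exponent `3`). [folklore] -/
theorem boxFloorSum_3_0_14 : boxFloorSum 2 3 0 14 40 3 (10 ^ 18) = 144829092121 := by
  decide +kernel

/-- `boxFloorSum 2 3 1 14 40 3 10^18` (pattern `1`, layer `14`, exponent `3`). [folklore] -/
theorem boxFloorSum_3_1_14 : boxFloorSum 2 3 1 14 40 3 (10 ^ 18) = 144828483617 := by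
  decide +kernel

/-- `boxFloorSum 2 3 0 15 40 3 10^18` (pattern `0`, layer `15`, exponent `3`). [folklore] -/
theorem boxFloorSum_3_0_15 : boxFloorSum 2 3 0 15 40 3 (10 ^ 18) = 109707417723 := by
  decide +kernel

/-- `boxFloorSum 2 3 1 15 40 3 10^18` (pattern `1`, layer `15`, exponent `3`). [folklore] -/
theorem boxFloorSum_3_1_15 : boxFloorSum 2 3 1 15 40 3 (10 ^ 18) = 109706838101 := by
  decide +kernel

/-- `boxFloorSum 2 3 0 16 40 3 10^18` (pattern `0`, layer `16`, exponent `3`). [folklore] -/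
theorem boxFloorSum_3_0_16 : boxFloorSum 2 3 0 16 40 3 (10 ^ 18) = 84570293551 := by
  decide +kernel

/-- `boxFloorSum 2 3 1 16 40 3 10^18` (pattern `1`, layer `16`, exponent `3`). [folklore] -/
theorem boxFloorSum_3_1_16 : boxFloorSum 2 3 1 16 40 3 (10 ^ 18) = 84569742987 := by
  decide +kernel

/-- `boxFloorSum 2 3 0 20 40 3 10^18` (pattern `0`, layer `20`, exponent `3`). [folklore] -/
theorem boxFloorSum_3_0_20 : boxFloorSum 2 3 0 20 40 3 (10 ^ 18) = 34231870694 := by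
  decide +kernel

/-- `boxFloorSum 2 3 1 20 40 3 10^18` (pattern `1`, layer `20`, exponent `3`). [folklore] -/
theorem boxFloorSum_3_1_20 : boxFloorSum 2 3 1 20 40 3 (10 ^ 18) = 34231432635 := by
  decide +kernel

/-- `boxFloorSum 2 3 0 21 40 3 10^18` (pattern `0`, layer `21`, exponent `3`). [folklore] -/
theorem boxFloorSum_3_0_21 : boxFloorSum 2 3 0 21 40 3 (10 ^ 18) = 28052390099 := by
  decide +kernel

/-- `boxFloorSum 2 3 1 21 40 3 10^18` (pattern `1`, layer `21`, exponent `3`). [folklore] -/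
theorem boxFloorSum_3_1_21 : boxFloorSum 2 3 1 21 40 3 (10 ^ 18) = 28051978516 := by
  decide +kernel

/-- `boxFloorSum 2 3 0 22 40 3 10^18` (pattern `0`, layer `22`, exponent `3`). [folklore] -/
theorem boxFloorSum_3_0_22 : boxFloorSum 2 3 0 22 40 3 (10 ^ 18) = 23188714880 := by
  decide +kernel

/-- `boxFloorSum 2 3 1 22 40 3 10^18` (pattern `1`, layer `22`, exponent `3`). [folklore] -/
theorem boxFloorSum_3_1_22 : boxFloorSum 2 3 1 22 40 3 (10 ^ 18) = 23188328920 := by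
  decide +kernel


end Literature.MathematicalPhysics.StatisticalMechanics.StackingSums

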